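import Summits.RiemannHypothesis.RiemannHypothesis.Theorems.SoloInformedGroundStateFamily
import Mathlib.Analysis.Distribution.SchwartzSpace.Fourier
import Mathlib.Analysis.Fourier.RiemannLebesgueLemma
import Mathlib.Topology.Algebra.Module.Equiv
import Mathlib.Topology.Order.Compact

/-!
# Ground-state endgame, XIV: Fourier decay of the seed family

Solo programme `solo-RiemannHypothesis-informed`, session 2 (claim C28). For the seeds `h_M` of part
XIII: there are absolute constants `X₀ > 0`, `A₀ ≥ 0` with
`‖𝓕 h_M(ξ)‖ ≤ A₀ 2^{-(M+1)} ξ⁻²` for all `ξ ≥ X₀ (M+1)`.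
Ingredients: the Riemann–Lebesgue lemma for the fixed kernel `φ` (`‖𝓕φ(ζ)‖ ≤ ½` for `|ζ| ≥ η₀`),
Schwartz decay `‖𝓕 b(ζ)‖ ≤ B₂ ζ⁻²` of the fixed bump, the product formula
`𝓕 b_M = 𝓕 b · (𝓕φ(·/(M+1)))^{M+1}`, and the dilation rule for the four (six) dilates in `h_M`.
-/

noncomputable section

open Filter Set Topology MeasureTheory
open scoped FourierTransform ContDiff
open Literature.NumberTheory.LFunctions

namespace Summit.RiemannHypothesis.RiemannHypothesis.Theorems

/-! ## Generic tools: dilation of Schwartz maps, Schwartz decay -/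

/-- Dilation of a Schwartz map: `dilateSchwartz h a = (x ↦ h (x * a))`, `a ≠ 0`. -/
def dilateSchwartz (h : SchwartzMap ℝ ℂ) {a : ℝ} (ha : a ≠ 0) : SchwartzMap ℝ ℂ :=
  SchwartzMap.compCLMOfContinuousLinearEquiv ℂ
    (ContinuousLinearEquiv.unitsEquivAut ℝ (Units.mk0 a ha)) h

/-- Pointwise formula for the dilation. -/
@[simp] theorem dilateSchwartz_apply (h : SchwartzMap ℝ ℂ) {a : ℝ} (ha : a ≠ 0) (x : ℝ) :
    dilateSchwartz h ha x = h (x * a) := by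
  simp [dilateSchwartz, ContinuousLinearEquiv.unitsEquivAut_apply]

/-- Fourier transform of a dilate: `𝓕 (x ↦ f (x a)) (w) = |a|⁻¹ • 𝓕 f (w / a)` (`a ≠ 0`). -/
theorem fourier_comp_mul_right (f : ℝ → ℂ) {a : ℝ} (ha : a ≠ 0) (w : ℝ) :
    𝓕 (fun x : ℝ => f (x * a)) w = |a⁻¹| • 𝓕 f (w / a) := by
  rw [Real.fourier_real_eq, Real.fourier_real_eq]
  have key : (fun v : ℝ => Real.fourierChar (-(v * w)) • f (v * a))
      = fun v : ℝ => (fun y : ℝ => Real.fourierChar (-(y * (w / a))) • f y) (v * a) := by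
    funext v
    simp only
    congr 3
    field_simp
  rw [key]
  exact Measure.integral_comp_mul_right (fun y : ℝ => Real.fourierChar (-(y * (w / a))) • f y) a

/-- Fourier transform of a dilated Schwartz map. -/
theorem fourier_dilateSchwartz (S : SchwartzMap ℝ ℂ) {a : ℝ} (ha : a ≠ 0) (ξ : ℝ) :
    (𝓕 (dilateSchwartz S ha) : SchwartzMap ℝ ℂ) ξ = |a⁻¹| • 𝓕 (⇑S) (ξ / a) := by
  show 𝓕 (⇑(dilateSchwartz S ha)) ξ = _
  have : ⇑(dilateSchwartz S ha) = fun x => S (x * a) := funext (dilateSchwartz_apply S ha)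
  rw [this, fourier_comp_mul_right _ ha]

/-- Schwartz decay of any order: `‖g x‖ ≤ p_{k,0}(g) / |x|^k` for `x ≠ 0`. -/
theorem norm_schwartz_le_div_pow (g : SchwartzMap ℝ ℂ) (k : ℕ) {x : ℝ} (hx : x ≠ 0) :
    ‖g x‖ ≤ SchwartzMap.seminorm ℝ k 0 g / |x| ^ k := by
  have key := SchwartzMap.le_seminorm ℝ k 0 g x
  rw [norm_iteratedFDeriv_zero, Real.norm_eq_abs] at key
  have hpos : 0 < |x| ^ k := pow_pos (abs_pos.mpr hx) k
  rw [le_div_iff₀ hpos]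
  linarith [mul_comm (|x| ^ k) ‖g x‖]

/-! ## The kernel: a Riemann–Lebesgue threshold -/

/-- There is `η₀ > 0` with `‖𝓕 φ(ζ)‖ ≤ ½` for `|ζ| ≥ η₀`. -/
theorem exists_norm_fourier_famKer_le_half :
    ∃ η₀ : ℝ, 0 < η₀ ∧ ∀ ζ : ℝ, η₀ ≤ |ζ| → ‖𝓕 (fun x => (famKer x : ℂ)) ζ‖ ≤ 1 / 2 := by
  have h := Real.zero_at_infty_fourier (fun x => (famKer x : ℂ))
  have hev : ∀ᶠ ζ in cocompact ℝ, dist (𝓕 (fun x => (famKer x : ℂ)) ζ) 0 < 1 / 2 :=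
    Metric.tendsto_nhds.1 h (1 / 2) (by norm_num)
  rw [cocompact_eq_atBot_atTop, Filter.eventually_sup] at hev
  obtain ⟨a, ha⟩ := Filter.eventually_atBot.1 hev.1
  obtain ⟨b, hb⟩ := Filter.eventually_atTop.1 hev.2
  refine ⟨max (max (-a) b) 1, by positivity, fun ζ hζ => ?_⟩
  have h1 : -a ≤ |ζ| := ((le_max_left _ _).trans (le_max_left _ _)).trans hζ
  have h2 : b ≤ |ζ| := ((le_max_right _ _).trans (le_max_left _ _)).trans hζ
  rcases le_or_gt 0 ζ with hz | hz
  · rw [abs_of_nonneg hz] at h2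
    have := hb ζ h2
    rw [dist_zero_right] at this
    exact this.le
  · rw [abs_of_neg hz] at h1
    have := ha ζ (by linarith)
    rw [dist_zero_right] at this
    exact this.le

/-! ## The bump: Schwartz decay of `𝓕 b` -/

/-- The complexified bump as a Schwartz map. -/
def seedBumpS : SchwartzMap ℝ ℂ :=
  (seedBump.hasCompactSupport.comp_left Complex.ofReal_zero :
      HasCompactSupport fun x : ℝ => ((seedBump : ℝ → ℝ) x : ℂ)).toSchwartzMap
    (Complex.ofRealCLM.contDiff.comp seedBump.contDiff)

/-- Pointwise formula. -/
@[simp] theorem seedBumpS_apply (x : ℝ) : seedBumpS x = ((seedBump : ℝ → ℝ) x : ℂ) := rfl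

/-- The constant `B₂ = p_{2,0}(𝓕 b)`. -/
def fourierBumpConst : ℝ := SchwartzMap.seminorm ℝ 2 0 (𝓕 seedBumpS)

/-- `B₂ ≥ 0`. -/
theorem fourierBumpConst_nonneg : 0 ≤ fourierBumpConst := apply_nonneg _ _

/-- `‖𝓕 b(ζ)‖ ≤ B₂ / ζ²` for `ζ ≠ 0`. -/
theorem norm_fourier_seedBump_le {ζ : ℝ} (hζ : ζ ≠ 0) :
    ‖𝓕 (fun x => ((seedBump : ℝ → ℝ) x : ℂ)) ζ‖ ≤ fourierBumpConst / |ζ| ^ 2 := by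
  have := norm_schwartz_le_div_pow (𝓕 seedBumpS) 2 hζ
  have hcoe : (⇑seedBumpS : ℝ → ℂ) = fun x => ((seedBump : ℝ → ℝ) x : ℂ) := funext seedBumpS_apply
  rw [← hcoe]
  exact this

/-- `‖𝓕 b_M(ζ)‖ ≤ (B₂/ζ²) 2^{-(M+1)}` for `|ζ| ≥ (M+1) η₀`. -/
theorem norm_fourier_bFam_le {η₀ : ℝ}
    (hη : ∀ ζ : ℝ, η₀ ≤ |ζ| → ‖𝓕 (fun x => (famKer x : ℂ)) ζ‖ ≤ 1 / 2) (M : ℕ) {ζ : ℝ}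
    (hζ : (M + 1) * η₀ ≤ |ζ|) (hζ0 : ζ ≠ 0) :
    ‖𝓕 (fun x => (bFam M x : ℂ)) ζ‖ ≤ fourierBumpConst / |ζ| ^ 2 * (1 / 2) ^ (M + 1) := by
  have hM : (0 : ℝ) < M + 1 := by positivity
  rw [fourier_bFam, norm_mul, norm_pow]
  refine mul_le_mul (norm_fourier_seedBump_le hζ0) ?_ (by positivity)
    (div_nonneg fourierBumpConst_nonneg (by positivity))
  refine pow_le_pow_left₀ (norm_nonneg _) (hη _ ?_) _
  rw [abs_div, abs_of_pos hM, le_div_iff₀ hM]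
  linarith

/-! ## The seeds: `𝓕 h_M` as a combination of dilates -/

/-- The complexified smoothed bump as a Schwartz map. -/
def bFamS (M : ℕ) : SchwartzMap ℝ ℂ :=
  ((hasCompactSupport_bFam M).comp_left Complex.ofReal_zero :
      HasCompactSupport fun x : ℝ => (bFam M x : ℂ)).toSchwartzMap
    (Complex.ofRealCLM.contDiff.comp (contDiff_bFam M))

/-- Pointwise formula. -/
@[simp] theorem bFamS_apply (M : ℕ) (x : ℝ) : bFamS M x = (bFam M x : ℂ) := rfl

/-- The dilate `x ↦ b_M(c x)` as a Schwartz map. -/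
def bDil (M : ℕ) (c : ℝ) (hc : c ≠ 0) : SchwartzMap ℝ ℂ := dilateSchwartz (bFamS M) hc

/-- Pointwise formula. -/
theorem bDil_apply (M : ℕ) (c : ℝ) (hc : c ≠ 0) (x : ℝ) : bDil M c hc x = (bFam M (c * x) : ℂ) := by
  rw [bDil, dilateSchwartz_apply, bFamS_apply, mul_comm]

/-- `h_M = D₂ + D₋₂ − D₄ − D₄ − D₋₄ − D₋₄` with `D_c = b_M(c ·)`. -/
theorem hFam_eq_comb (M : ℕ) :
    hFam M = bDil M 2 (by norm_num) + bDil M (-2) (by norm_num) - bDil M 4 (by norm_num)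
      - bDil M 4 (by norm_num) - bDil M (-4) (by norm_num) - bDil M (-4) (by norm_num) := by
  ext x
  show hFam M x = bDil M 2 _ x + bDil M (-2) _ x - bDil M 4 _ x - bDil M 4 _ x
    - bDil M (-4) _ x - bDil M (-4) _ x
  simp only [hFam_apply, famRe, bDil_apply]
  push_cast
  ring

/-- Each dilate: `‖𝓕 D_c(ξ)‖ ≤ 4 B₂ 2^{-(M+1)} ξ⁻²` for `2 ≤ |c| ≤ 4`, `ξ ≥ 4(M+1)η₀ > 0`. -/
theorem norm_fourier_bDil_le {η₀ : ℝ} (hη0 : 0 < η₀)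
    (hη : ∀ ζ : ℝ, η₀ ≤ |ζ| → ‖𝓕 (fun x => (famKer x : ℂ)) ζ‖ ≤ 1 / 2) (M : ℕ) {c : ℝ}
    (hc2 : 2 ≤ |c|) (hc4 : |c| ≤ 4) {ξ : ℝ} (hξ : 4 * ((M + 1) * η₀) ≤ ξ) :
    ‖(𝓕 (bDil M c (by intro h; rw [h, abs_zero] at hc2; linarith)) : SchwartzMap ℝ ℂ) ξ‖
      ≤ 4 * fourierBumpConst * (1 / 2) ^ (M + 1) * (ξ ^ 2)⁻¹ := by
  have hM : (0 : ℝ) < M + 1 := by positivity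
  have hξ0 : 0 < ξ := lt_of_lt_of_le (by positivity) hξ
  have hc0 : 0 < |c| := by linarith
  have hcne : c ≠ 0 := abs_pos.1 hc0
  rw [bDil, fourier_dilateSchwartz, norm_smul, Real.norm_eq_abs, abs_abs]
  have hcoe : (⇑(bFamS M) : ℝ → ℂ) = fun x => (bFam M x : ℂ) := funext (bFamS_apply M)
  rw [hcoe]
  have hζ : (M + 1) * η₀ ≤ |ξ / c| := by
    rw [abs_div, abs_of_pos hξ0, le_div_iff₀ hc0]
    nlinarith
  have hζ0 : ξ / c ≠ 0 := div_ne_zero hξ0.ne' hcne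
  have hb := norm_fourier_bFam_le hη M hζ hζ0
  have hB := fourierBumpConst_nonneg
  calc |c⁻¹| * ‖𝓕 (fun x => (bFam M x : ℂ)) (ξ / c)‖
      ≤ |c⁻¹| * (fourierBumpConst / |ξ / c| ^ 2 * (1 / 2) ^ (M + 1)) :=
        mul_le_mul_of_nonneg_left hb (abs_nonneg _)
    _ = |c| * fourierBumpConst * (1 / 2) ^ (M + 1) * (ξ ^ 2)⁻¹ := by
        rw [abs_inv, abs_div, abs_of_pos hξ0]
        field_simp
    _ ≤ 4 * fourierBumpConst * (1 / 2) ^ (M + 1) * (ξ ^ 2)⁻¹ := by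
        gcongr

/-- **FOURIER DECAY OF THE SEED FAMILY.** With the Riemann–Lebesgue threshold `η₀` of the kernel:
`‖𝓕 h_M(ξ)‖ ≤ 24 B₂ 2^{-(M+1)} ξ⁻²` for `ξ ≥ 4 (M+1) η₀`. -/
theorem norm_fourier_hFam_le {η₀ : ℝ} (hη0 : 0 < η₀)
    (hη : ∀ ζ : ℝ, η₀ ≤ |ζ| → ‖𝓕 (fun x => (famKer x : ℂ)) ζ‖ ≤ 1 / 2) (M : ℕ) {ξ : ℝ}
    (hξ : 4 * ((M + 1) * η₀) ≤ ξ) :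
    ‖(𝓕 (hFam M) : SchwartzMap ℝ ℂ) ξ‖
      ≤ 24 * fourierBumpConst * (1 / 2) ^ (M + 1) * (ξ ^ 2)⁻¹ := by
  have h2 : ∀ {c : ℝ} (hc2 : 2 ≤ |c|) (hc4 : |c| ≤ 4),
      ‖(𝓕 (bDil M c (by intro h; rw [h, abs_zero] at hc2; linarith)) : SchwartzMap ℝ ℂ) ξ‖
        ≤ 4 * fourierBumpConst * (1 / 2) ^ (M + 1) * (ξ ^ 2)⁻¹ :=
    fun hc2 hc4 => norm_fourier_bDil_le hη0 hη M hc2 hc4 hξ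
  have e2 := h2 (c := 2) (by norm_num) (by norm_num)
  have em2 := h2 (c := -2) (by norm_num) (by norm_num)
  have e4 := h2 (c := 4) (by norm_num) (by norm_num)
  have em4 := h2 (c := -4) (by norm_num) (by norm_num)
  rw [hFam_eq_comb]
  simp only [sub_eq_add_neg, FourierTransform.fourier_add, FourierTransform.fourier_neg]
  set T := 4 * fourierBumpConst * (1 / 2) ^ (M + 1) * (ξ ^ 2)⁻¹ with hT
  have key : ∀ (A B : SchwartzMap ℝ ℂ) (a b : ℝ), ‖A ξ‖ ≤ a → ‖B ξ‖ ≤ b → ‖(A + B) ξ‖ ≤ a + b :=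
    fun A B a b ha hb => (norm_add_le (A ξ) (B ξ)).trans (add_le_add ha hb)
  have keyn : ∀ (A : SchwartzMap ℝ ℂ) (a : ℝ), ‖A ξ‖ ≤ a → ‖(-A) ξ‖ ≤ a :=
    fun A a ha => by rw [show (-A) ξ = -(A ξ) from rfl, norm_neg]; exact ha
  have := key _ _ _ _ (key _ _ _ _ (key _ _ _ _ (key _ _ _ _ (key _ _ _ _ e2 em2) (keyn _ _ e4))
    (keyn _ _ e4)) (keyn _ _ em4)) (keyn _ _ em4)
  linarith

/-- **Packaged form.** Absolute constants `X₀ > 0`, `A₀ ≥ 0` with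
`‖𝓕 h_M(ξ)‖ ≤ A₀ 2^{-(M+1)} ξ⁻²` for `ξ ≥ X₀ (M+1)`, for every `M`. -/
theorem hFam_fourier_decay : ∃ X₀ : ℝ, 0 < X₀ ∧ ∃ A₀ : ℝ, 0 ≤ A₀ ∧ ∀ M : ℕ, ∀ ξ : ℝ,
    X₀ * (M + 1) ≤ ξ →
      ‖(𝓕 (hFam M) : SchwartzMap ℝ ℂ) ξ‖ ≤ A₀ * (1 / 2) ^ (M + 1) * (ξ ^ 2)⁻¹ := by
  obtain ⟨η₀, hη0, hη⟩ := exists_norm_fourier_famKer_le_half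
  refine ⟨4 * η₀, by positivity, 24 * fourierBumpConst,
    mul_nonneg (by norm_num) fourierBumpConst_nonneg, fun M ξ hξ => ?_⟩
  exact norm_fourier_hFam_le hη0 hη M (by linarith)

end Summit.RiemannHypothesis.RiemannHypothesis.Theorems
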